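import Summits.BirchSwinnertonDyer.BirchSwinnertonDyer.Theorems.ManinLocalTwoThreeCoprimeIsolatedResidualSplit
import Summits.BirchSwinnertonDyer.BirchSwinnertonDyer.Theorems.ManinLocalTwoThreeKummerCubeNotCube
import Literature.NumberTheory.EllipticCurves.KatoAdditiveTwistedValueNeronIntegralityThreeKPForms
import HarnessLib

/-!
# C3 `ManinPrimeToThreeAtNine` ⟸ Kato `F₃` ∧ RAT₃ ∧ RES₃♭, where RAT₃ = «a rational short `3`-torsion point on a lattice-optimal
# curve at `9 ∣ N` forces `3 ∤ c`» — the composition variant the UDC line needs (an g37 L-an-g37-7), and the v20 reading recovered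
Summit `BirchSwinnertonDyer`, route `ManinLocalTwoThree` (cell bsd-f2-manin), crux C3 `ManinPrimeToThreeAtNine` (stmt-BirchSwinnertonDyer-22968);
lead p1 gen 15.  CONFIRMATION for an g37 (MEMO-an §80.12, L-an-g37-7): in the v10/v20 composition
`maninPrimeToThreeAtNine_of_katoFact_of_cuspidalKummerCube_of_noBlindLaws_of_coprimeIsolated` the hypotheses `h57` (E-an-57), `hLaw′` (LAW₃♮)
and `hNB` (NB₃) serve ONLY to exclude `3 ∣ c` on the rational-short-`3`-torsion locus of lattice-optimal data at `9 ∣ N`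
(`orbitMinimalReducibleResidualThree_of_cuspidalKummerCube`, case `∃ X₀ Y₀, IsShortThreeTorsion`; and inside RES₃′ ⟸ hTors ∧ RES₃♭).
Hence the clean cut:
* **`maninPrimeToThreeAtNine_of_katoFact_of_ratThreeTorsion_of_coprimeIsolated`** — C3 ⟸ F-es-18 (polar Kato fact) ∧ **RAT₃**
  (`∀` lattice-optimal `X₀(M)`-datum with `9 ∣ M` and a rational short `3`-torsion point: `3 ∤ c`) ∧ RES₃♭; `…_kp` form with F₃♮
  (`polar_of_kp`).  Any closer of RAT₃ — an's UDC line (`reducibleCaseAtNine_of_udc`, once `UDCKummerLine` lands: RAT₃ ⟸ its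
  `ReducibleCaseAtNine` by `exists_isParamGerm`), or E-an-57 ∧ LAW₃ ∧ E-an-55 — plugs in here.
* **`ratThreeTorsion_of_cuspidalKummerCubeRepresentative`** — the v20 reading: RAT₃ ⟸ E-an-57 ALONE, since LAW₃
  (`KummerCubeNotCube.cuspidalKummerCubeExponentLaw`, an's σ-monodromy chain landed by p2) and E-an-55 (`ManinThreeKummerCube_holds`) are
  THEOREMS; so **`maninPrimeToThreeAtNine_of_katoFact_of_e57_of_coprimeIsolated`**: C3 ⟸ F₃♮ ∧ E-an-57 ∧ RES₃♭ with NO NB₃ / LAW₃♮ binder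
  (= skeleton v20's content, by name).
HONEST FRAMING: CONDITIONAL compositions; F₃♮ is a printed statement-only Kato fact, E-an-57 / RAT₃ / RES₃♭ are OPEN; C3, Manin's conjecture and
BSD are NOT proved.  No definitions, no sorry.
[cite: Kato2004Asterisque, Thm. 9.7 (p. 189)] [cite: Stevens1989, §2]
-/

set_option autoImplicit false
-- the summit-side namespace `Summit.BirchSwinnertonDyer.BirchSwinnertonDyer.…` is the tree's (summit = sub-problem)
set_option linter.dupNamespace false

noncomputable section

open scoped Classical MatrixGroups ModularForm
open PowerSeries CongruenceSubgroup
open WeierstrassCurve Literature.NumberTheory.EllipticCurves Literature.NumberTheory.EllipticCurves.ModularForms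
open Summit.BirchSwinnertonDyer.Rank1Residual.ManinAdditive
open Summit.BirchSwinnertonDyer.Rank1Residual.ManinAdditive.CuspidalKummer
open Summit.BirchSwinnertonDyer.Rank1Residual.ManinAdditive.CuspidalKummerThree

namespace Summit.BirchSwinnertonDyer.BirchSwinnertonDyer.Theorems.ManinLocalTwoThree

/-- **C3 ⟸ F-es-18 ∧ RAT₃ ∧ RES₃♭.**  The orbit-minimal reducible residual splits on «∃ rational short `3`-torsion point»: the YES branch is
RAT₃ verbatim, the NO branch is RES₃′ ⟸ RAT₃ ∧ RES₃♭ (`noRationalThreeTorsionOrbitMinimalResidual_of_coprimeIsolated`); then the lead's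
`maninPrimeToThreeAtNine_of_katoFact_of_orbitMinimalReducible`.  CONDITIONAL. [cite: Kato2004Asterisque, Thm. 9.7 (p. 189)] -/
theorem maninPrimeToThreeAtNine_of_katoFact_of_ratThreeTorsion_of_coprimeIsolated
    (hK : kato_neron_isIntegral_twistedSymbolSum_of_additive_three_polar)
    (hTors : ∀ (B : WeierstrassCurve ℚ) [B.IsElliptic] [B.IsGloballyMinimal] {M : ℕ} [NeZero M]
      (DB : ModularParametrizationData B M), 9 ∣ M →
      (∀ z ∈ DB.L.lattice, ∃ w ∈ periodLattice DB.f, z = DB.c * w) →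
      ∀ X₀ Y₀ : ℚ, IsShortThreeTorsion B DB.c X₀ Y₀ → ¬ (3 : ℤ) ∣ DB.c)
    (hRes : NoRationalThreeTorsionCoprimeIsolatedResidual) :
    Summit.BirchSwinnertonDyer.BirchSwinnertonDyer.Theses.ManinLocalTwoThree.ManinPrimeToThreeAtNine := by
  have hRes' : NoRationalThreeTorsionOrbitMinimalResidual :=
    noRationalThreeTorsionOrbitMinimalResidual_of_coprimeIsolated hTors hRes
  refine maninPrimeToThreeAtNine_of_katoFact_of_orbitMinimalReducible hK ?_
  intro W _ _ N _ D hopt h9 hc1 hc2 hc3 hc4 hc5 hc6 hred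
  have h9' : 9 ∣ N := by norm_num at h9; exact h9
  by_cases hT : ∃ X₀ Y₀ : ℚ, IsShortThreeTorsion W D.c X₀ Y₀
  · obtain ⟨X₀, Y₀, hT⟩ := hT
    exact hTors W D h9' hopt X₀ Y₀ hT
  · push Not at hT
    exact hRes' W D hopt h9 hc1 hc2 hc3 hc4 hc5 hc6 hred hT

/-- The same with Kato's fact in Kosters–Pannekoek form F₃♮ (`polar_of_kp`). CONDITIONAL. [cite: Kato2004Asterisque, Thm. 9.7 (p. 189)] -/
theorem maninPrimeToThreeAtNine_of_katoFactKP_of_ratThreeTorsion_of_coprimeIsolated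
    (hK : kato_neron_isIntegral_twistedSymbolSum_of_additive_three_kp)
    (hTors : ∀ (B : WeierstrassCurve ℚ) [B.IsElliptic] [B.IsGloballyMinimal] {M : ℕ} [NeZero M]
      (DB : ModularParametrizationData B M), 9 ∣ M →
      (∀ z ∈ DB.L.lattice, ∃ w ∈ periodLattice DB.f, z = DB.c * w) →
      ∀ X₀ Y₀ : ℚ, IsShortThreeTorsion B DB.c X₀ Y₀ → ¬ (3 : ℤ) ∣ DB.c)
    (hRes : NoRationalThreeTorsionCoprimeIsolatedResidual) :
    Summit.BirchSwinnertonDyer.BirchSwinnertonDyer.Theses.ManinLocalTwoThree.ManinPrimeToThreeAtNine :=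
  maninPrimeToThreeAtNine_of_katoFact_of_ratThreeTorsion_of_coprimeIsolated (polar_of_kp hK) hTors hRes

/-- **RAT₃ ⟸ E-an-57 alone** (the v20 reading): LAW₃ is the tree theorem `KummerCubeNotCube.cuspidalKummerCubeExponentLaw` (σ-monodromy chain) and
E-an-55/58 is `ManinPrimeToThreeOfEtaExponent_holds`, so `not_three_dvd_maninConstant_of_shortThreeTorsion_forall` needs only E-an-57.
CONDITIONAL on E-an-57. [cite: Stevens1989, §2] -/
theorem ratThreeTorsion_of_cuspidalKummerCubeRepresentative (h57 : CuspidalKummerCubeRepresentativeAtNine) :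
    ∀ (B : WeierstrassCurve ℚ) [B.IsElliptic] [B.IsGloballyMinimal] {M : ℕ} [NeZero M]
      (DB : ModularParametrizationData B M), 9 ∣ M →
      (∀ z ∈ DB.L.lattice, ∃ w ∈ periodLattice DB.f, z = DB.c * w) →
      ∀ X₀ Y₀ : ℚ, IsShortThreeTorsion B DB.c X₀ Y₀ → ¬ (3 : ℤ) ∣ DB.c :=
  Summit.BirchSwinnertonDyer.BirchSwinnertonDyer.Theorems.not_three_dvd_maninConstant_of_shortThreeTorsion_forall h57
    KummerCubeNotCube.cuspidalKummerCubeExponentLaw ManinPrimeToThreeOfEtaExponent_holds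

/-- **C3 ⟸ F₃♮ ∧ E-an-57 ∧ RES₃♭** — skeleton v20's content by name, with NO NB₃ / LAW₃♮ / P79 binder.  CONDITIONAL; C3 OPEN.
[cite: Kato2004Asterisque, Thm. 9.7 (p. 189)] -/
theorem maninPrimeToThreeAtNine_of_katoFactKP_of_e57_of_coprimeIsolated
    (hK : kato_neron_isIntegral_twistedSymbolSum_of_additive_three_kp)
    (h57 : CuspidalKummerCubeRepresentativeAtNine) (hRes : NoRationalThreeTorsionCoprimeIsolatedResidual) :
    Summit.BirchSwinnertonDyer.BirchSwinnertonDyer.Theses.ManinLocalTwoThree.ManinPrimeToThreeAtNine :=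
  maninPrimeToThreeAtNine_of_katoFactKP_of_ratThreeTorsion_of_coprimeIsolated hK
    (ratThreeTorsion_of_cuspidalKummerCubeRepresentative h57) hRes

end Summit.BirchSwinnertonDyer.BirchSwinnertonDyer.Theorems.ManinLocalTwoThree

end
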